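import Mathlib.RingTheory.Unramified.LocalRing
import Mathlib.RingTheory.Finiteness.Nakayama
import Mathlib.AlgebraicGeometry.Morphisms.Finite
import Mathlib.AlgebraicGeometry.Morphisms.FormallyUnramified
import Mathlib.AlgebraicGeometry.Morphisms.ClosedImmersion
import Mathlib.Topology.JacobsonSpace
import HarnessLib

/-!
# A finite unramified morphism which is injective on points (with trivial residue extensions at the
# closed points) is a closed immersion (Hartshorne II Prop. 7.3 / Lemma 7.4; EGA IV 17.2.6, 8.11.5)

Layer `Literature/AlgebraicGeometry/Morphisms`, namespace `Literature.AlgebraicGeometry.Morphisms`.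
THEOREMS ONLY (no definition, no named fact, no instance, sorry-free); Mathlib-only imports.

Hartshorne II Prop. 7.3 proves that a morphism `φ : X → ℙⁿ` of a projective variety over `k = k̄` which is
injective on closed points and on tangent vectors is a closed immersion; the scheme-theoretic heart (after
«projective ⇒ finite onto the image») is Lemma 7.4-style commutative algebra: a finite local homomorphism
`A → B` with `B/𝔪_A B = k` is surjective (Nakayama).  EGA IV 17.2.6 / 8.11.5 phrase the same as
«a finite unramified radicial morphism is a closed immersion».  This file records the criterion in the form
consumed by the tree (e.g. the Abel–Jacobi map `f^P : C → J`, Milne *Jacobian Varieties* Prop. 2.3, whose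
finiteness and injectivity are ★ `Motives/JacobianAbelJacobiInjective` and whose unramifiedness comes from
Weil's chart):

* §1 (rings) `map_eq_top_of_primesOver_eq_empty` (`pS = S` if no prime lies over the maximal `p`),
  **`map_eq_of_primesOver_eq_singleton`** (`pS = q` if `q` is the ONLY prime over the maximal `p` and `S` is
  unramified at `q`: Mathlib `Algebra.isUnramifiedAt_iff_map_eq` gives `pS_q = qS_q`, and `q` is the only
  maximal ideal above `pS`), `eq_top_of_forall_isMaximal_le_sup_smul` (global Nakayama: `M = N + pM` for all
  maximal `p` forces `N = M`, Mathlib `Submodule.exists_sub_one_mem_and_smul_eq_zero_of_fg_of_le_smul`), and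
  **`surjective_algebraMap_of_finite_of_subsingleton_primesOver`**: a module-finite `R → S` with at most
  one prime over each maximal ideal, unramified there, and `R ↠ S/q` for the maximal `q`, is SURJECTIVE.
* §2 (evaluation) `evaluation_fromSpec_eq_zero_iff` (the kernel of evaluation at the point of an affine
  open `U` attached to `P ⊆ Γ(X, U)` is `P`) and `evaluation_fromSpec_surjective` (evaluation at the point
  of a MAXIMAL `P` is onto the residue field; Mathlib `IsAffineOpen.isLocalization_stalk'`).
* §3 **`isClosedImmersion_of_isFinite_of_formallyUnramified_of_injective`**: `f : X → Y` FINITE, FORMALLY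
  UNRAMIFIED, INJECTIVE on points, inducing surjections `κ(f x) → κ(x)` at the CLOSED points `x` of the
  Jacobson scheme `X` ⇒ `f` is a CLOSED IMMERSION (Mathlib `isClosedImmersion_iff_isAffineHom` + §1 on
  each affine chart, transported by `IsAffineOpen.SpecMap_appLE_fromSpec`, `Scheme.evaluation_naturality`).
  Only MAXIMAL ideals enter §1, so nothing is assumed at the non-closed points beyond unramifiedness:
  birationality onto the image is a consequence, not an input.  Over `k = k̄` the residue condition at
  closed points is ★ `Motives.AbelianVarietyProjectiveChart.surjective_residueFieldMap_of_isClosed`.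

Cell `hodgecm-mathlib` (D-0151), count-neutral capital (road (N) of the tangent clause of Milne JV
Prop. 2.3, census `A-provers/A-p12/g11/CENSUS-MilneProp23-TangentClause.A-p12g11.md`).  HC_CM is proved
only modulo the 7 printed citations until rung 0 closes; this file discharges none of them.

Mathlib searched (pin): `Localization.localRingHom_surjective_of_primesOver_eq_singleton` (the local
form; not used — the global Nakayama above avoids identifying `S_p` with `S_q`),
`Algebra.isUnramifiedAt_iff_map_eq`, `Algebra.formallyUnramified_iff_forall`, `isClosedImmersion_iff_isAffineHom`,
`IsClosedImmersion.iff_isFinite_and_mono`, `tfae_universallyInjective` (needs purely inseparable residue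
extensions at ALL points — not available at generic points in the applications), `HasRingHomProperty.appLE`,
`targetAffineLocally_affineAnd_iff'`, `IsAffineOpen.SpecMap_appLE_fromSpec`, `IsAffineOpen.isLocalization_stalk'`,
`Scheme.evaluation_naturality_apply`, `IsOpenEmbedding.preimage_closedPoints` (all but the first and
`tfae_universallyInjective` used).

## References

* R. Hartshorne, *Algebraic Geometry*, GTM 52 (1977), II Prop. 7.3 and Lemma 7.4 (pp. 152–153). [Hartshorne1977]
* A. Grothendieck, *EGA IV₃*, Publ. Math. IHÉS 28 (1966), 8.11.5. [EGAIV3]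
* A. Grothendieck, *EGA IV₄*, Publ. Math. IHÉS 32 (1967), 17.2.6, 17.4.1. [EGAIV4]
* J. S. Milne, *Jacobian Varieties* (1986), §2 Prop. 2.3. [Milne1986JacobianVarieties]
-/

set_option autoImplicit false

universe u

open CategoryTheory AlgebraicGeometry TopologicalSpace Opposite

namespace Literature.AlgebraicGeometry.Morphisms

/-! ## §1 Commutative algebra: a finite algebra, unramified with trivial residue extensions and at most one
prime over each maximal ideal, is a quotient -/

section Ring

variable {R S : Type*} [CommRing R] [CommRing S] [Algebra R S]

/-- If no prime of `S` lies over the maximal ideal `p`, then `pS = S`. [folklore] -/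
private theorem map_eq_top_of_primesOver_eq_empty (p : Ideal R) [hp : p.IsMaximal]
    (h : p.primesOver S = ∅) : p.map (algebraMap R S) = ⊤ := by
  by_contra hne
  obtain ⟨m, hm, hle⟩ := Ideal.exists_le_maximal _ hne
  have hpm : p = m.under R :=
    hp.eq_of_le (Ideal.comap_ne_top _ hm.ne_top) (Ideal.map_le_iff_le_comap.mp hle)
  have : m ∈ p.primesOver S := ⟨hm.isPrime, ⟨hpm⟩⟩
  rw [h] at this
  exact this

/-- A maximal ideal containing `pS` lies over the maximal ideal `p`. [folklore] -/
private theorem liesOver_of_map_le (p : Ideal R) [hp : p.IsMaximal] (m : Ideal S) [hm : m.IsMaximal]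
    (hle : p.map (algebraMap R S) ≤ m) : m.LiesOver p :=
  ⟨hp.eq_of_le (Ideal.comap_ne_top _ hm.ne_top) (Ideal.map_le_iff_le_comap.mp hle)⟩

/-- **`pS = q` when `q` is the only prime over the maximal ideal `p` and `S` is unramified at `q`**
(EGA IV 17.4.1 / Stacks 00UW at a maximal ideal: `pS_q = qS_q`, and `q` is the only maximal ideal containing
`pS`). [cite: EGAIV4, 17.4.1] -/
theorem map_eq_of_primesOver_eq_singleton [Algebra.EssFiniteType R S] (p : Ideal R) [hp : p.IsMaximal]
    (q : Ideal S) [hqp : q.IsPrime] (hq : p.primesOver S = {q}) [Algebra.IsUnramifiedAt R q] :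
    p.map (algebraMap R S) = q := by
  have hmem : q ∈ p.primesOver S := by rw [hq]; exact Set.mem_singleton q
  haveI : q.LiesOver p := hmem.2
  letI := Localization.AtPrime.algebraOfLiesOver p q
  obtain ⟨-, hmap⟩ := (Algebra.isUnramifiedAt_iff_map_eq R p q).mp ‹_›
  apply le_antisymm
  · rw [Ideal.map_le_iff_le_comap]
    exact le_of_eq (Ideal.LiesOver.over (p := p) (P := q))
  · intro x hx
    have h1 : algebraMap S (Localization.AtPrime q) x ∈
        (p.map (algebraMap R S)).map (algebraMap S (Localization.AtPrime q)) := by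
      rw [Ideal.map_map, ← IsScalarTower.algebraMap_eq, hmap]
      exact (IsLocalization.AtPrime.to_map_mem_maximal_iff (Localization.AtPrime q) q x).mpr hx
    obtain ⟨⟨⟨i, hi⟩, ⟨s, hs⟩⟩, e⟩ := (IsLocalization.mem_map_algebraMap_iff q.primeCompl _).mp h1
    change algebraMap S _ x * algebraMap S _ s = algebraMap S _ i at e
    rw [← map_mul] at e
    obtain ⟨⟨t, ht⟩, e'⟩ := (IsLocalization.eq_iff_exists q.primeCompl _).mp e
    change t * (x * s) = t * i at e'
    have hu : t * s ∉ q := fun h => (hqp.mem_or_mem h).elim ht hs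
    -- `pS + (ts) = S`: a maximal ideal above both would be a second prime over `p`
    have htop : p.map (algebraMap R S) ⊔ Ideal.span {t * s} = ⊤ := by
      by_contra hne
      obtain ⟨m, hm, hle⟩ := Ideal.exists_le_maximal _ hne
      haveI := liesOver_of_map_le p m (le_sup_left.trans hle)
      have hm' : m ∈ p.primesOver S := ⟨hm.isPrime, ‹_›⟩
      rw [hq, Set.mem_singleton_iff] at hm'
      exact hu (hm' ▸ hle (Ideal.mem_sup_right (Ideal.mem_span_singleton_self _)))
    have h1S : (1 : S) ∈ p.map (algebraMap R S) ⊔ Ideal.span {t * s} := htop ▸ Submodule.mem_top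
    obtain ⟨a, ha, b, hb, hab⟩ := Submodule.mem_sup.mp h1S
    obtain ⟨c, rfl⟩ := Ideal.mem_span_singleton'.mp hb
    have hx' : x = a * x + c * (t * i) := by
      calc x = (a + c * (t * s)) * x := by rw [hab, one_mul]
        _ = a * x + c * (t * (x * s)) := by ring
        _ = a * x + c * (t * i) := by rw [e']
    rw [hx']
    exact Ideal.add_mem _ (Ideal.mul_mem_right _ _ ha)
      (Ideal.mul_mem_left _ _ (Ideal.mul_mem_left _ _ hi))

/-- **Nakayama, global form**: an `R`-submodule `N` of the finite `R`-module `M` with `M = N + pM` for every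
maximal ideal `p` is everything (Nakayama at each maximal ideal: the annihilator of `M/N` lies in no maximal
ideal). [cite: AtiyahMacdonald1969, Cor. 2.7 (Nakayama) and Prop. 3.8] -/
theorem eq_top_of_forall_isMaximal_le_sup_smul {M : Type*} [AddCommGroup M] [Module R M] [Module.Finite R M]
    (N : Submodule R M) (h : ∀ (p : Ideal R) [p.IsMaximal], ⊤ ≤ N ⊔ p • ⊤) : N = ⊤ := by
  -- pass to the quotient `M/N`, where `p • ⊤ = ⊤` for every maximal `p`
  by_contra hN
  have hnt : Nontrivial (M ⧸ N) := (Submodule.Quotient.nontrivial_iff (p := N)).mpr hN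
  let A : Ideal R := Module.annihilator R (M ⧸ N)
  have hA : A ≠ ⊤ := by
    intro hA
    have h1 : (1 : R) ∈ A := hA ▸ Submodule.mem_top
    obtain ⟨z, hz⟩ := exists_ne (0 : M ⧸ N)
    exact hz (by simpa using Module.mem_annihilator.mp h1 z)
  obtain ⟨p, hp, hAp⟩ := Ideal.exists_le_maximal A hA
  have hle : (⊤ : Submodule R (M ⧸ N)) ≤ p • ⊤ := by
    intro z _
    obtain ⟨m, rfl⟩ := Submodule.Quotient.mk_surjective N z
    have hm : m ∈ N ⊔ p • ⊤ := h p Submodule.mem_top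
    obtain ⟨n, hn, y, hy, rfl⟩ := Submodule.mem_sup.mp hm
    rw [Submodule.Quotient.mk_add, (Submodule.Quotient.mk_eq_zero N).mpr hn, zero_add,
      ← Submodule.mkQ_apply, ← Submodule.mem_comap]
    refine Submodule.smul_induction_on hy (fun r hr y _ => ?_) (fun y₁ y₂ h₁ h₂ => Submodule.add_mem _ h₁ h₂)
    rw [Submodule.mem_comap, map_smul]
    exact Submodule.smul_mem_smul hr Submodule.mem_top
  obtain ⟨r, hr1, hr⟩ := Submodule.exists_sub_one_mem_and_smul_eq_zero_of_fg_of_le_smul p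
    (⊤ : Submodule R (M ⧸ N)) Module.Finite.fg_top hle
  have hrA : r ∈ A := Module.mem_annihilator.mpr fun z => hr z Submodule.mem_top
  exact hp.ne_top ((Ideal.eq_top_iff_one _).mpr (by simpa using Ideal.sub_mem _ (hAp hrA) hr1))

/-- **A finite algebra with at most one prime over each maximal ideal, unramified there with trivial
residue extension, is a quotient of the base** (the algebra behind Hartshorne II Lemma 7.4 / EGA IV
8.11.5: `R → S` is surjective iff it is so after localising at every maximal ideal, where Nakayama
reduces to the fibre `S/pS = S/q = κ(q) ↞ R`). [cite: EGAIV3, 8.11.5] [cite: EGAIV4, 17.2.6]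
[cite: Hartshorne1977, II Lemma 7.4 (proof)] -/
theorem surjective_algebraMap_of_finite_of_subsingleton_primesOver [Module.Finite R S]
    (h1 : ∀ (p : Ideal R) [p.IsMaximal], (p.primesOver S).Subsingleton)
    (h2 : ∀ (p : Ideal R) [p.IsMaximal] (q : Ideal S) [q.IsPrime], q ∈ p.primesOver S →
      Algebra.IsUnramifiedAt R q)
    (h3 : ∀ (q : Ideal S) [q.IsMaximal], Function.Surjective (algebraMap R (S ⧸ q))) :
    Function.Surjective (algebraMap R S) := by
  haveI : Algebra.FiniteType R S := Module.Finite.finiteType (A := S)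
  haveI : Algebra.EssFiniteType R S := inferInstance
  suffices h : LinearMap.range (Algebra.linearMap R S) = ⊤ from
    fun s => by simpa using (h ▸ Submodule.mem_top : s ∈ LinearMap.range (Algebra.linearMap R S))
  refine eq_top_of_forall_isMaximal_le_sup_smul _ fun p hp => ?_
  intro s _
  rw [Ideal.smul_top_eq_map]
  by_cases hex : (p.primesOver S).Nonempty
  · obtain ⟨q, hq⟩ := hex
    haveI := hq.1
    haveI := hq.2
    have hsing : p.primesOver S = {q} :=
      Set.eq_singleton_iff_unique_mem.mpr ⟨hq, fun q' hq' => h1 p hq' hq⟩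
    haveI := h2 p q hq
    haveI : q.IsMaximal := Ideal.isMaximal_of_isIntegral_of_isMaximal_comap (R := R) q
      (by rw [← Ideal.under_def, ← Ideal.LiesOver.over (p := p) (P := q)]; exact hp)
    have hpq : p.map (algebraMap R S) = q := map_eq_of_primesOver_eq_singleton p q hsing
    obtain ⟨r, hr⟩ := h3 q (Ideal.Quotient.mk q s)
    rw [IsScalarTower.algebraMap_apply R S (S ⧸ q), Ideal.Quotient.algebraMap_eq, Ideal.Quotient.eq] at hr
    refine Submodule.mem_sup.mpr ⟨algebraMap R S r, ⟨r, rfl⟩, s - algebraMap R S r, ?_, by abel⟩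
    change s - algebraMap R S r ∈ p.map (algebraMap R S)
    rw [hpq]
    -- `hr : algebraMap R S r - s ∈ q`
    have := q.neg_mem_iff.mpr hr
    rwa [neg_sub] at this
  · rw [Set.not_nonempty_iff_eq_empty] at hex
    rw [map_eq_top_of_primesOver_eq_empty p hex]
    exact Submodule.mem_sup_right trivial

end Ring

/-! ## §2 Evaluation at the points of an affine open -/

section Evaluation

variable {X : Scheme.{u}} {U : X.Opens} (hU : IsAffineOpen U)

/-- Every point of `Spec Γ(X, U)` maps into `U` under `fromSpec`. [folklore] -/
private theorem fromSpec_mem (P : PrimeSpectrum Γ(X, U)) : hU.fromSpec P ∈ U := by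
  rw [← SetLike.mem_coe, ← hU.range_fromSpec]
  exact ⟨P, rfl⟩

/-- **The kernel of evaluation at the point of `U` attached to a prime `P ⊆ Γ(X, U)` is `P`** (`U` affine:
the residue field at `𝔭 ∈ Spec A` is `κ(𝔭) = A_𝔭/𝔭A_𝔭` and `s(𝔭) = 0 ⟺ s ∈ 𝔭`).
[cite: GortzWedhorn2020, (2.3.3) and the paragraph preceding §(2.5) (values `f(x) ∈ κ(x)` on `Spec A`)] -/
theorem evaluation_fromSpec_eq_zero_iff (P : PrimeSpectrum Γ(X, U)) (s : Γ(X, U)) :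
    X.evaluation U (hU.fromSpec P) (fromSpec_mem hU P) s = 0 ↔ s ∈ P.asIdeal := by
  rw [Scheme.evaluation_eq_zero_iff_notMem_basicOpen]
  have : hU.fromSpec P ∈ X.basicOpen s ↔ P ∈ PrimeSpectrum.basicOpen s := by
    rw [← hU.fromSpec_preimage_basicOpen]
    rfl
  rw [this, PrimeSpectrum.mem_basicOpen, not_not]

/-- **Evaluation at the point attached to a MAXIMAL ideal `P ⊆ Γ(X, U)` is surjective**: the stalk is the
localisation at `P` (Mathlib `IsAffineOpen.isLocalization_stalk'`), and `a/b ≡ a·c (mod 𝔪)` for `c b ≡ 1 (mod P)`;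
i.e. `κ(𝔪) = A/𝔪` for a maximal ideal `𝔪` of `A = Γ(X, U)`.
[cite: GortzWedhorn2020, (2.3.3) and the paragraph preceding §(2.5) (residue fields of `Spec A`)] -/
theorem evaluation_fromSpec_surjective (P : PrimeSpectrum Γ(X, U)) (hP : P.asIdeal.IsMaximal) :
    Function.Surjective (X.evaluation U (hU.fromSpec P) (fromSpec_mem hU P)) := by
  set x := hU.fromSpec P with hx
  have hxU : x ∈ U := fromSpec_mem hU P
  letI : Algebra Γ(X, U) (X.presheaf.stalk x) := TopCat.Presheaf.algebra_section_stalk X.presheaf ⟨x, hxU⟩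
  haveI : IsLocalization.AtPrime (X.presheaf.stalk x) P.asIdeal := hU.isLocalization_stalk' P hxU
  intro z
  obtain ⟨w, rfl⟩ := X.residue_surjective x z
  obtain ⟨⟨a, ⟨b, hb⟩⟩, rfl⟩ := IsLocalization.mk'_surjective P.asIdeal.primeCompl w
  obtain ⟨c, i, hi, hci⟩ := hP.exists_inv hb
  refine ⟨a * c, ?_⟩
  change X.residue x (X.presheaf.germ U x hxU (a * c)) = X.residue x _
  rw [← sub_eq_zero, ← map_sub]
  change IsLocalRing.residue (X.presheaf.stalk x) _ = 0
  rw [IsLocalRing.residue_eq_zero_iff]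
  -- `(germ (a c) − a/b) · b = germ (a (c b − 1)) = −germ (a i) ∈ 𝔪`
  have hgerm : ∀ t : Γ(X, U), (X.presheaf.germ U x hxU) t = algebraMap Γ(X, U) (X.presheaf.stalk x) t :=
    fun t => rfl
  have hunit : IsUnit (algebraMap Γ(X, U) (X.presheaf.stalk x) b) :=
    IsLocalization.map_units _ (⟨b, hb⟩ : P.asIdeal.primeCompl)
  have e1 : algebraMap Γ(X, U) (X.presheaf.stalk x) b * IsLocalization.mk' (X.presheaf.stalk x) a ⟨b, hb⟩ =
      algebraMap Γ(X, U) (X.presheaf.stalk x) a := IsLocalization.mk'_spec' _ a ⟨b, hb⟩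
  rw [hgerm, ← Ideal.unit_mul_mem_iff_mem _ hunit, mul_sub, e1, ← map_mul, ← map_sub]
  have hmem : b * (a * c) - a ∈ P.asIdeal := by
    have : b * (a * c) - a = -(a * i) := by
      have hci' : i = 1 - c * b := by rw [← hci]; ring
      rw [hci']; ring
    rw [this]
    exact P.asIdeal.neg_mem_iff.mpr (P.asIdeal.mul_mem_left a hi)
  exact (IsLocalization.AtPrime.to_map_mem_maximal_iff (X.presheaf.stalk x) P.asIdeal _).mpr hmem

/-- Transport of `evaluation_fromSpec_surjective` along an equality of points.
[cite: GortzWedhorn2020, (2.3.3) and the paragraph preceding §(2.5) (residue fields of `Spec A`)] -/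
theorem evaluation_surjective_of_eq_fromSpec (P : PrimeSpectrum Γ(X, U)) (hP : P.asIdeal.IsMaximal) {y : X}
    (hy : y ∈ U) (e : y = hU.fromSpec P) : Function.Surjective (X.evaluation U y hy) := by
  subst e
  exact evaluation_fromSpec_surjective hU P hP

end Evaluation

/-! ## §3 Finite + unramified + injective on points ⇒ closed immersion -/

section Scheme

variable {X Y : Scheme.{u}} (f : X ⟶ Y)

/-- **A finite, (formally) unramified morphism which is injective on points and induces surjections on
the residue fields of the closed points is a closed immersion** (`X` Jacobson, e.g. locally of finite type
over a field; over an algebraically closed field the residue-field condition is automatic at closed points).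
This is the criterion in the proof of Hartshorne II Prop. 7.3 («injective on points and on tangent
vectors») / EGA IV 8.11.5 + 17.2.6: closed-immersion-ness is affine-local on `Y` (Mathlib
`isClosedImmersion_iff_isAffineHom`), and on an affine chart `Spec S → Spec R` it is §1
(`surjective_algebraMap_of_finite_of_subsingleton_primesOver`): at most one prime over each maximal ideal
(injectivity), unramified there (Mathlib `Algebra.formallyUnramified_iff_forall`), residue extension
trivial.  NOTE: no hypothesis at the non-closed points beyond unramifiedness — birationality onto the image
is a consequence. [cite: Hartshorne1977, II Prop. 7.3 (proof) and Lemma 7.4] [cite: EGAIV3, 8.11.5]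
[cite: EGAIV4, 17.2.6] -/
theorem isClosedImmersion_of_isFinite_of_formallyUnramified_of_injective [IsFinite f] [FormallyUnramified f]
    [JacobsonSpace X] (hinj : Function.Injective f)
    (hres : ∀ x : X, IsClosed ({x} : Set X) → Function.Surjective (f.residueFieldMap x)) :
    IsClosedImmersion f := by
  refine isClosedImmersion_iff_isAffineHom.mpr ⟨inferInstance, fun U hU => ?_⟩
  have hV : IsAffineOpen (f ⁻¹ᵁ U) := hU.preimage f
  -- the ring map of the chart and its properties
  have happ : f.appLE U (f ⁻¹ᵁ U) le_rfl = f.app U := (Scheme.Hom.app_eq_appLE f).symm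
  have hfin : (f.app U).hom.Finite := by
    have h := (HasAffineProperty.eq_targetAffineLocally (P := @IsFinite)) ▸ (inferInstance : IsFinite f)
    exact ((targetAffineLocally_affineAnd_iff' RingHom.finite_respectsIso f).mp h).2 U hU
  have hunr : (f.app U).hom.FormallyUnramified := by
    rw [← happ]
    exact HasRingHomProperty.appLE @FormallyUnramified f inferInstance ⟨U, hU⟩ ⟨f ⁻¹ᵁ U, hV⟩ le_rfl
  algebraize [(f.app U).hom]
  -- `Spec` of the chart is injective on points: `Spec (f♯) ≫ fromSpec_U = fromSpec_V ≫ f`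
  have hnat : Spec.map (f.app U) ≫ hU.fromSpec = hV.fromSpec ≫ f := by
    rw [← happ]
    exact IsAffineOpen.SpecMap_appLE_fromSpec f hU hV le_rfl
  have hSpec : Function.Injective (Spec.map (f.app U)) := by
    intro q₁ q₂ h
    have e : f (hV.fromSpec q₁) = f (hV.fromSpec q₂) := by
      rw [← Scheme.Hom.comp_apply, ← Scheme.Hom.comp_apply, ← hnat, Scheme.Hom.comp_apply,
        Scheme.Hom.comp_apply, h]
    exact hV.fromSpec.isOpenEmbedding.injective (hinj e)
  refine surjective_algebraMap_of_finite_of_subsingleton_primesOver ?_ ?_ ?_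
  · -- at most one prime over each maximal (indeed each) ideal
    intro p _ q₁ hq₁ q₂ hq₂
    have h1 : (Spec.map (f.app U)) ⟨q₁, hq₁.1⟩ = (Spec.map (f.app U)) ⟨q₂, hq₂.1⟩ := by
      apply PrimeSpectrum.ext
      rw [Spec.map_apply, Spec.map_apply, PrimeSpectrum.comap_asIdeal, PrimeSpectrum.comap_asIdeal]
      change q₁.under Γ(Y, U) = q₂.under Γ(Y, U)
      rw [← hq₁.2.over, ← hq₂.2.over]
    exact congrArg PrimeSpectrum.asIdeal (hSpec h1)
  · -- unramified at every prime
    intro p _ q hq _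
    exact (Algebra.formallyUnramified_iff_forall (R := Γ(Y, U)) (A := Γ(X, f ⁻¹ᵁ U))).mp hunr ⟨q, hq⟩
  · -- residue fields at the closed points
    intro q hq s'
    obtain ⟨s, rfl⟩ := Ideal.Quotient.mk_surjective s'
    let Q : PrimeSpectrum Γ(X, f ⁻¹ᵁ U) := ⟨q, hq.isPrime⟩
    set x := hV.fromSpec Q with hx
    have hxV : x ∈ f ⁻¹ᵁ U := fromSpec_mem hV Q
    -- `x` is closed in `X` (closed in the open `f⁻¹U`, and `X` is Jacobson)
    have hxcl : IsClosed ({x} : Set X) := by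
      have hQ : Q ∈ closedPoints (Spec Γ(X, f ⁻¹ᵁ U) : Scheme.{u}) :=
        (PrimeSpectrum.isClosed_singleton_iff_isMaximal Q).mpr hq
      rw [← hV.fromSpec.isOpenEmbedding.preimage_closedPoints] at hQ
      exact hQ
    -- the image point and its prime
    have hfx : f x = hU.fromSpec (Spec.map (f.app U) Q) := by
      rw [hx, ← Scheme.Hom.comp_apply, ← hnat, Scheme.Hom.comp_apply]
    have hPmax : (Spec.map (f.app U) Q).asIdeal.IsMaximal := by
      rw [Spec.map_apply, PrimeSpectrum.comap_asIdeal]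
      exact Ideal.isMaximal_comap_of_isIntegral_of_isMaximal (R := Γ(Y, U)) q
    -- evaluate: `ev_x (s) = resMap (ev_y r)` for some `r`, so `s − f♯ r ∈ ker ev_x = q`
    have hyU : f x ∈ U := hxV
    obtain ⟨c, hc⟩ := hres x hxcl (X.evaluation (f ⁻¹ᵁ U) x hxV s)
    obtain ⟨r, hr⟩ : ∃ r : Γ(Y, U), Y.evaluation U (f x) hyU r = c :=
      evaluation_surjective_of_eq_fromSpec hU (Spec.map (f.app U) Q) hPmax hyU hfx c
    refine ⟨r, ?_⟩
    rw [IsScalarTower.algebraMap_apply Γ(Y, U) Γ(X, f ⁻¹ᵁ U) (Γ(X, f ⁻¹ᵁ U) ⧸ q), Ideal.Quotient.algebraMap_eq,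
      Ideal.Quotient.eq]
    change (f.app U) r - s ∈ Q.asIdeal
    rw [← evaluation_fromSpec_eq_zero_iff hV Q, map_sub, sub_eq_zero]
    change X.evaluation (f ⁻¹ᵁ U) x hxV (f.app U r) = X.evaluation (f ⁻¹ᵁ U) x hxV s
    rw [← Scheme.evaluation_naturality_apply f x hyU r, hr, hc]

end Scheme

end Literature.AlgebraicGeometry.Morphisms
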